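import Literature.Analysis.FluidPDE.BackwardParticleMap
import Literature.Analysis.FluidPDE.TrajectoryGradientBound
import HarnessLib

/-!
# Vorticity amplification along particle trajectories is bounded by the trajectory gradient:
# `|ω(X(α,t),t)| ≤ |∇_αX(α,t)| |ω₀(α)| ≤ e^{∫₀ᵗ|∇v|₀} |ω₀(α)|` (Majda–Bertozzi (1.51) with (4.47))

Literature file (topic `Analysis/FluidPDE`), a leaf over `ParticleTrajectoryFlow.lean` /
`BackwardParticleMap.lean` (MB Prop. 1.8 (1.51) "`ω(X(α,t),t) = ∇_αX(α,t) ω₀(α)`" for classical 3D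
Euler solutions along `X(·,t) = ODE.evolutionMap u 0 t`, and its Eulerian form (2.115)–(2.117)
"`ω(x,t) = ∇_αX(X⁻¹(x,t),t) ω₀(X⁻¹(x,t))`") and `TrajectoryGradientBound.lean` (MB (4.47)
"`|∇_αX(·,t)|₀ ≤ exp ∫₀ᵗ |∇v(·,s)|₀ ds`"). Combining the two printed statements: the vorticity
carried by a fluid particle is amplified at most by the operator norm of the trajectory gradient,
hence at most by `exp ∫₀ᵗ |∇v(·,s)|₀ ds`; in Eulerian variables
`|ω(x,t)| ≤ e^{∫₀ᵗ M} |ω₀(X⁻¹(x,t))| ≤ e^{∫₀ᵗ M} |ω₀|₀` for `|∇v(·,s)|₀ ≤ M(s)` — the elementary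
half of the Beale–Kato–Majda mechanism ("the solution exists … provided we have an a priori bound on
`∫₀ᵀ |∇v(·,t)|_{L^∞} dt`", MB p. 105). Theorems only; no definitions, no named facts.

HONEST FRAMING (cell `pub-fluidc`): typed textbook infrastructure for a low prior, high
value-of-information experiment on Tao's machine paradigm; NOT a claim that NS blows up.

## References

* [MajdaBertozziCUP2002] A. J. Majda, A. L. Bertozzi, Vorticity and Incompressible Flow, CUP 2002
  — §1.6 Prop. 1.8 eq. (1.51) (held text p. 25); §2.5 (2.115)–(2.117) (p. 71); §4.2 (4.47)
  (p. 133); §3.3 (3.79)–(3.80) (p. 105).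
-/

noncomputable section

open Set Function Filter Topology Real
open scoped ContDiff NNReal

namespace Literature.Analysis.FluidPDE

section Euler3

variable {S : Set ℝ} {u : ℝ → EuclideanSpace ℝ (Fin 3) → EuclideanSpace ℝ (Fin 3)}
  {p : ℝ → EuclideanSpace ℝ (Fin 3) → ℝ} {t : ℝ}

/-- **`|ω(X(α,t),t)| ≤ ‖∇_αX(α,t)‖ |ω₀(α)|`** (operator norm) for a classical unforced Euler
solution along its particle trajectories within the convex time set `S ∋ 0`: the norm of (1.51).
[cite: MajdaBertozziCUP2002, §1.6 Prop. 1.8 eq. (1.51) (held text p. 25)] -/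
theorem IsClassicalNSSolutionOn.norm_curl_evolutionMap_le (h : IsClassicalEulerSolutionOn S 0 u p)
    (hS : Convex ℝ S) (h0 : (0 : ℝ) ∈ S) (hU : UniqueDiffOn ℝ S)
    (hL : ODE.IsUniformlyLipschitzOn u S) (ht : t ∈ S) (a : EuclideanSpace ℝ (Fin 3)) :
    ‖curl (u t) (ODE.evolutionMap u 0 t a)‖ ≤
      ‖fderiv ℝ (ODE.evolutionMap u 0 t) a‖ * ‖curl (u 0) a‖ := by
  rw [h.curl_evolutionMap hS h0 hU hL ht a]
  exact ContinuousLinearMap.le_opNorm _ _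

/-- **`|ω(X(α,t),t)| ≤ e^{M|t|} |ω₀(α)|`** when `‖∇u(s,·)‖ ≤ M` between the times `0` and `t`
((1.51) with the constant-modulus (4.47)). [cite: MajdaBertozziCUP2002, §1.6 Prop. 1.8 (1.51) (p. 25); §4.2 (4.47) (p. 133)] -/
theorem IsClassicalNSSolutionOn.norm_curl_evolutionMap_le_exp (h : IsClassicalEulerSolutionOn S 0 u p)
    (hS : Convex ℝ S) (h0 : (0 : ℝ) ∈ S) (hU : UniqueDiffOn ℝ S)
    (hL : ODE.IsUniformlyLipschitzOn u S) (ht : t ∈ S) {M : ℝ}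
    (hM : ∀ s ∈ uIcc 0 t, ∀ x, ‖fderiv ℝ (u s) x‖ ≤ M) (a : EuclideanSpace ℝ (Fin 3)) :
    ‖curl (u t) (ODE.evolutionMap u 0 t a)‖ ≤ exp (M * |t|) * ‖curl (u 0) a‖ :=
  (h.norm_curl_evolutionMap_le hS h0 hU hL ht a).trans (mul_le_mul_of_nonneg_right
    (norm_fderiv_evolutionMap_zero_le hL h.smooth_velocity hS hU h0 ht hM a) (norm_nonneg _))

/-- **`|ω(X(α,t),t)| ≤ exp(∫₀ᵗ |∇v(·,s)|₀ ds) |ω₀(α)|`**: for `0 ≤ t ∈ S` and a continuous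
modulus `‖∇u(s,·)‖ ≤ M(s)` on `[0, t]` ((1.51) with (4.47) as printed).
[cite: MajdaBertozziCUP2002, §1.6 Prop. 1.8 (1.51) (p. 25); §4.2 (4.47) (p. 133)] -/
theorem IsClassicalNSSolutionOn.norm_curl_evolutionMap_le_exp_integral
    (h : IsClassicalEulerSolutionOn S 0 u p) (hS : Convex ℝ S) (h0 : (0 : ℝ) ∈ S)
    (hU : UniqueDiffOn ℝ S) (hL : ODE.IsUniformlyLipschitzOn u S) (ht : t ∈ S) (h0t : 0 ≤ t)
    {M : ℝ → ℝ} (hMc : ContinuousOn M (Icc 0 t)) (hM : ∀ s ∈ Icc 0 t, ∀ x, ‖fderiv ℝ (u s) x‖ ≤ M s)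
    (a : EuclideanSpace ℝ (Fin 3)) :
    ‖curl (u t) (ODE.evolutionMap u 0 t a)‖ ≤ exp (∫ s in (0 : ℝ)..t, M s) * ‖curl (u 0) a‖ :=
  (h.norm_curl_evolutionMap_le hS h0 hU hL ht a).trans (mul_le_mul_of_nonneg_right
    (norm_fderiv_evolutionMap_zero_le_exp_integral hL h.smooth_velocity hS hU h0 ht h0t hMc hM a)
    (norm_nonneg _))

/-- **Eulerian form: `|ω(x,t)| ≤ exp(∫₀ᵗ |∇v(·,s)|₀ ds) |ω₀(X⁻¹(x,t))|`**, `X⁻¹(·,t) = φ(0,t,·)`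
((2.115)–(2.117) with (4.47)). [cite: MajdaBertozziCUP2002, §2.5 (2.115)–(2.117) (p. 71); §4.2 (4.47) (p. 133)] -/
theorem IsClassicalNSSolutionOn.norm_curl_le_exp_integral (h : IsClassicalEulerSolutionOn S 0 u p)
    (hS : Convex ℝ S) (h0 : (0 : ℝ) ∈ S) (hU : UniqueDiffOn ℝ S)
    (hL : ODE.IsUniformlyLipschitzOn u S) (ht : t ∈ S) (h0t : 0 ≤ t) {M : ℝ → ℝ}
    (hMc : ContinuousOn M (Icc 0 t)) (hM : ∀ s ∈ Icc 0 t, ∀ x, ‖fderiv ℝ (u s) x‖ ≤ M s)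
    (x : EuclideanSpace ℝ (Fin 3)) :
    ‖curl (u t) x‖ ≤ exp (∫ s in (0 : ℝ)..t, M s) * ‖curl (u 0) (ODE.evolutionMap u t 0 x)‖ := by
  have h1 := h.norm_curl_evolutionMap_le_exp_integral hS h0 hU hL ht h0t hMc hM
    (ODE.evolutionMap u t 0 x)
  rwa [hL.evolutionMap_trans hS ht h0 ht, ODE.evolutionMap_self] at h1

/-- **The sup form: `|ω(·,t)|₀ ≤ exp(∫₀ᵗ |∇v(·,s)|₀ ds) |ω₀|₀`** — if `|ω₀(α)| ≤ W` for all `α`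
then `|ω(x,t)| ≤ exp(∫₀ᵗ M) W` for all `x` (vorticity growth requires growth of
`∫₀ᵗ |∇v(·,s)|₀ ds`). [cite: MajdaBertozziCUP2002, §2.5 (2.115)–(2.117) (p. 71); §4.2 (4.47) (p. 133); §3.3 after (3.79) (p. 105)] -/
theorem IsClassicalNSSolutionOn.norm_curl_le_exp_integral_mul (h : IsClassicalEulerSolutionOn S 0 u p)
    (hS : Convex ℝ S) (h0 : (0 : ℝ) ∈ S) (hU : UniqueDiffOn ℝ S)
    (hL : ODE.IsUniformlyLipschitzOn u S) (ht : t ∈ S) (h0t : 0 ≤ t) {M : ℝ → ℝ}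
    (hMc : ContinuousOn M (Icc 0 t)) (hM : ∀ s ∈ Icc 0 t, ∀ x, ‖fderiv ℝ (u s) x‖ ≤ M s)
    {W : ℝ} (hW : ∀ a, ‖curl (u 0) a‖ ≤ W) (x : EuclideanSpace ℝ (Fin 3)) :
    ‖curl (u t) x‖ ≤ exp (∫ s in (0 : ℝ)..t, M s) * W :=
  (h.norm_curl_le_exp_integral hS h0 hU hL ht h0t hMc hM x).trans
    (mul_le_mul_of_nonneg_left (hW _) (exp_pos _).le)

/-- **Lower bound by the inverse gradient: `|ω₀(α)| ≤ ‖∇X⁻¹(·,t)(X(α,t))‖ |ω(X(α,t),t)|`** —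
vorticity cannot be depleted faster than the backward map stretches ((1.51) inverted through
`∇X⁻¹(X(α,t),t) ∇_αX(α,t) = I`). [cite: MajdaBertozziCUP2002, §1.6 Prop. 1.8 (1.51) (p. 25); §1.3 (1.13)–(1.14)] -/
theorem IsClassicalNSSolutionOn.norm_curl_zero_le (h : IsClassicalEulerSolutionOn S 0 u p)
    (hS : Convex ℝ S) (h0 : (0 : ℝ) ∈ S) (hU : UniqueDiffOn ℝ S)
    (hL : ODE.IsUniformlyLipschitzOn u S) (ht : t ∈ S) (a : EuclideanSpace ℝ (Fin 3)) :
    ‖curl (u 0) a‖ ≤ ‖fderiv ℝ (ODE.evolutionMap u t 0) (ODE.evolutionMap u 0 t a)‖ *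
      ‖curl (u t) (ODE.evolutionMap u 0 t a)‖ := by
  -- the chain rule for `φ(0,t,·) ∘ φ(t,0,·) = id` at `a`
  have hd1 : DifferentiableAt ℝ (ODE.evolutionMap u 0 t) a :=
    ((contDiff_evolutionMap_slice hL h.smooth_velocity hS hU h0 ht).differentiable
      (by simp)).differentiableAt
  have hd2 : DifferentiableAt ℝ (ODE.evolutionMap u t 0) (ODE.evolutionMap u 0 t a) :=
    ((contDiff_evolutionMap_slice hL h.smooth_velocity hS hU ht h0).differentiable
      (by simp)).differentiableAt
  have hcomp : ODE.evolutionMap u t 0 ∘ ODE.evolutionMap u 0 t = id :=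
    funext fun y => hL.evolutionMap_symm hS h0 ht y
  have hchain : (fderiv ℝ (ODE.evolutionMap u t 0) (ODE.evolutionMap u 0 t a)).comp
      (fderiv ℝ (ODE.evolutionMap u 0 t) a) = ContinuousLinearMap.id ℝ _ := by
    rw [← fderiv_comp a hd2 hd1, hcomp, fderiv_id]
  have hid : curl (u 0) a = fderiv ℝ (ODE.evolutionMap u t 0) (ODE.evolutionMap u 0 t a)
      (curl (u t) (ODE.evolutionMap u 0 t a)) := by
    rw [h.curl_evolutionMap hS h0 hU hL ht a, ← ContinuousLinearMap.comp_apply, hchain,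
      ContinuousLinearMap.id_apply]
  rw [hid]
  exact ContinuousLinearMap.le_opNorm _ _

end Euler3

end Literature.Analysis.FluidPDE

end
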